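import Summits.ABC.ABC.Theses.FeketeScales
import Literature.NumberTheory.DiophantineGeometry.AbcWave0QualityFormProofs

/-!
# Quasi-polynomial abc from ε-slack scale sub-multiplicativity (route FeketeScales)

Item `stmt-ABC-2164`, decl `Summit.ABC.ABC.Theses.FeketeScales.QuasiPolynomialAbcOfEpsSubmult`
(the audit's "honest core" of the idea card `fekete-submultiplicative-extremal`, F3).

**Statement.** If for every `ε > 0` there are `K > 0` and `R₀` such that every abc triple with
`rad(abc) ≤ R₁ R₂` (`R₁, R₂ ≥ R₀`) satisfies `c ≤ K (R₁R₂)^ε c₁ c₂` for SOME abc triples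
`(aᵢ, bᵢ, cᵢ)` with `rad ≤ Rᵢ` (ε-slack scale sub-multiplicativity of the extremal height — a
consequence of abc), and abc triples with prescribed support are finitely many (abc.S25,
`finite_setOf_isABCTriple_primeFactors_subset`, Mahler 1933 — taken as a hypothesis, as the item
states it; it is discharged in the tree), then for every `ε > 0` there is `C` with
`log c ≤ C · log rad(abc) + ε · log rad(abc) · log log rad(abc)` for every abc triple.

**Proof (pure doubling; the leading constant `C` is free, so no binary-digit bookkeeping is
needed).** Fix `ε`, put `ε' := ε (log 2)/2`, take `K, R₀` from the hypothesis at `ε'`, the base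
scale `R := max R₀ 3` (`t₀ := log R ≥ 1`) and `L := max (log K) 0`. By abc.S25 the triples with
`rad ≤ R` are finitely many (their primes are `≤ R`), so `log c ≤ A` for them. Induction on `i`
(the hypothesis at `R₁ = R₂ = R^(2^i)`):
`rad(abc) ≤ R^(2^i) ⟹ log c ≤ 2^i (A + L + ε' i t₀) − L`.
For a triple with radical `r` let `n` be minimal with `r ≤ R^(2^n)`. If `n = 0`, `log c ≤ A`. If
`n = i + 1`, then `R^(2^i) < r` gives `2^i t₀ < log r` and (as `t₀ ≥ 1`) `i log 2 < log log r`, so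
`log c ≤ 2 (A + L) log r + 2 ε' (i+1) log r ≤ (2(A+L) + 2ε') log r + (2ε'/log 2) log r log log r`,
and `2ε'/log 2 = ε`. The only triples with `log log rad < 0` have `log rad < 1`, where
`log r · log log r ≥ log r − 1 ≥ −1`, absorbed by `C ≥ (A + ε)/log 2`.

References: the item's informal sketch (route FeketeScales, planner); Fekete's lemma
(Mathlib `Subadditive`) is the pattern, not used formally.
-/

-- `Summit.<Summit>.<Problem>` is the mandated summit-side namespace (CONVENTIONS §2); for the
-- single-conjunct summit `ABC` the two coincide, so the duplicate `ABC.ABC` is deliberate.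
set_option linter.dupNamespace false

namespace Summit.ABC.ABC.Theorems

open Literature.NumberTheory.DiophantineGeometry

/-- **Base scale (abc.S25).** Under `finite_setOf_isABCTriple_primeFactors_subset`, the abc
triples with `rad(abc) ≤ R` are finitely many (every prime factor of `abc` divides the radical,
hence is `≤ R`), so `log c` is bounded on them by some `A ≥ 0`. [folklore] -/
theorem QuasiPolynomialAbcOfEpsSubmult.exists_log_le_of_rad_le
    (hS : finite_setOf_isABCTriple_primeFactors_subset) (R : ℕ) :
    ∃ A : ℝ, 0 ≤ A ∧ ∀ a b c : ℕ, IsABCTriple a b c → rad a b c ≤ R → Real.log c ≤ A := by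
  have hfin : {t : ℕ × ℕ × ℕ | IsABCTriple t.1 t.2.1 t.2.2 ∧ rad t.1 t.2.1 t.2.2 ≤ R}.Finite := by
    refine (hS (Finset.range (R + 1))).subset ?_
    rintro ⟨a, b, c⟩ ⟨ht, hR⟩
    refine ⟨ht, fun p hp => ?_⟩
    dsimp only at hp hR ⊢
    have hple : p ≤ rad a b c := by
      rw [rad_def]
      rw [← Nat.primeFactors_radical] at hp
      exact Nat.le_of_dvd (Nat.radical_pos _) (Nat.dvd_of_mem_primeFactors hp)
    exact Finset.mem_range.mpr (by omega)
  obtain ⟨M, hM⟩ := (hfin.image fun t => t.2.2).bddAbove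
  refine ⟨M, Nat.cast_nonneg M, fun a b c ht hR => ?_⟩
  have hcM : c ≤ M := hM ⟨(a, b, c), ⟨ht, hR⟩, rfl⟩
  have hc0 : (0 : ℝ) < c := by exact_mod_cast lt_of_lt_of_le zero_lt_two ht.two_le
  calc Real.log c ≤ (c : ℝ) := (Real.log_le_sub_one_of_pos hc0).trans (by linarith)
    _ ≤ M := by exact_mod_cast hcM

/-- **Doubling step.** With `K, R₀` from the ε'-slack sub-multiplicativity, a base scale
`R ≥ R₀` with `R ≥ 1`, `t₀ := log R`, `L := max (log K) 0` and a base bound `A` on `log c` over the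
triples with `rad ≤ R`: every abc triple with `rad(abc) ≤ R^(2^i)` has
`log c ≤ 2^i (A + L + ε' i t₀) − L`. Induction on `i`, applying the hypothesis at
`R₁ = R₂ = R^(2^i)`. [folklore] -/
theorem QuasiPolynomialAbcOfEpsSubmult.log_le_of_rad_le_pow {ε' K : ℝ} {R₀ R : ℕ} (hK : 0 < K)
    (hsub : ∀ R₁ R₂ : ℕ, R₀ ≤ R₁ → R₀ ≤ R₂ → ∀ a b c : ℕ, IsABCTriple a b c →
      rad a b c ≤ R₁ * R₂ → ∃ a₁ b₁ c₁ a₂ b₂ c₂ : ℕ, IsABCTriple a₁ b₁ c₁ ∧ rad a₁ b₁ c₁ ≤ R₁ ∧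
        IsABCTriple a₂ b₂ c₂ ∧ rad a₂ b₂ c₂ ≤ R₂ ∧ (c : ℝ) ≤ K * ((R₁ : ℝ) * R₂) ^ ε' * c₁ * c₂)
    (hR₀R : R₀ ≤ R) (hR1 : 1 ≤ R) {A : ℝ}
    (hA : ∀ a b c : ℕ, IsABCTriple a b c → rad a b c ≤ R → Real.log c ≤ A) (i : ℕ) :
    ∀ a b c : ℕ, IsABCTriple a b c → rad a b c ≤ R ^ (2 ^ i) →
      Real.log c ≤ 2 ^ i * (A + max (Real.log K) 0 + ε' * i * Real.log R) - max (Real.log K) 0 := by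
  induction i with
  | zero =>
    intro a b c ht hr
    have h := hA a b c ht (by simpa using hr)
    simp only [pow_zero, Nat.cast_zero, mul_zero, zero_mul, add_zero, one_mul]
    linarith
  | succ i ih =>
    intro a b c ht hr
    have hRi : R₀ ≤ R ^ 2 ^ i := hR₀R.trans (Nat.le_self_pow (pow_ne_zero _ two_ne_zero) R)
    have hR2 : R ^ 2 ^ (i + 1) = R ^ 2 ^ i * R ^ 2 ^ i := by rw [pow_succ, pow_mul, sq]
    rw [hR2] at hr
    obtain ⟨a₁, b₁, c₁, a₂, b₂, c₂, ht₁, hr₁, ht₂, hr₂, hle⟩ := hsub _ _ hRi hRi a b c ht hr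
    have h₁ := ih a₁ b₁ c₁ ht₁ hr₁
    have h₂ := ih a₂ b₂ c₂ ht₂ hr₂
    have hc0 : (0 : ℝ) < c := by exact_mod_cast lt_of_lt_of_le zero_lt_two ht.two_le
    have hc₁0 : (0 : ℝ) < c₁ := by exact_mod_cast lt_of_lt_of_le zero_lt_two ht₁.two_le
    have hc₂0 : (0 : ℝ) < c₂ := by exact_mod_cast lt_of_lt_of_le zero_lt_two ht₂.two_le
    have hRpos : (0 : ℝ) < R := by exact_mod_cast hR1
    have hXpos : (0 : ℝ) < ((R ^ 2 ^ i : ℕ) : ℝ) * ((R ^ 2 ^ i : ℕ) : ℝ) := by positivity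
    have hlogX : Real.log ((((R ^ 2 ^ i : ℕ) : ℝ) * ((R ^ 2 ^ i : ℕ) : ℝ)) ^ ε') =
        ε' * (2 ^ (i + 1) * Real.log R) := by
      rw [Real.log_rpow hXpos, Real.log_mul (by positivity) (by positivity)]
      push_cast
      rw [Real.log_pow]
      push_cast
      ring
    have hlog : Real.log (K * ((((R ^ 2 ^ i : ℕ) : ℝ) * ((R ^ 2 ^ i : ℕ) : ℝ)) ^ ε') * c₁ * c₂) =
        Real.log K + ε' * (2 ^ (i + 1) * Real.log R) + Real.log c₁ + Real.log c₂ := by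
      rw [Real.log_mul (by positivity) hc₂0.ne', Real.log_mul (by positivity) hc₁0.ne',
        Real.log_mul hK.ne' (by positivity), hlogX]
    have hlogle : Real.log c ≤
        Real.log K + ε' * (2 ^ (i + 1) * Real.log R) + Real.log c₁ + Real.log c₂ := by
      rw [← hlog]
      exact Real.log_le_log hc0 hle
    have hLK : Real.log K ≤ max (Real.log K) 0 := le_max_left _ _
    calc Real.log c
        ≤ max (Real.log K) 0 + ε' * (2 ^ (i + 1) * Real.log R) +
          (2 ^ i * (A + max (Real.log K) 0 + ε' * i * Real.log R) - max (Real.log K) 0) +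
          (2 ^ i * (A + max (Real.log K) 0 + ε' * i * Real.log R) - max (Real.log K) 0) := by
          linarith
      _ = 2 ^ (i + 1) * (A + max (Real.log K) 0 + ε' * ((i + 1 : ℕ) : ℝ) * Real.log R) -
          max (Real.log K) 0 := by
          push_cast
          ring

/-- **Item `stmt-ABC-2164` (route FeketeScales, support): quasi-polynomial abc from ε-slack scale
sub-multiplicativity.** ε-slack sub-multiplicativity of the abc extremal height across radical
scales, together with abc.S25 (finiteness of abc triples with prescribed support), gives for
every `ε > 0` a constant `C` with `log c ≤ C log rad(abc) + ε log rad(abc) log log rad(abc)` for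
all abc triples. Proof: base scale by abc.S25, doubling induction
(`QuasiPolynomialAbcOfEpsSubmult.log_le_of_rad_le_pow`), minimal dyadic exponent. [folklore] -/
theorem quasiPolynomialAbcOfEpsSubmult_proof :
    Summit.ABC.ABC.Theses.FeketeScales.QuasiPolynomialAbcOfEpsSubmult := by
  unfold Summit.ABC.ABC.Theses.FeketeScales.QuasiPolynomialAbcOfEpsSubmult
  intro hsub hS ε hε
  have hlog2 : 0 < Real.log 2 := Real.log_pos one_lt_two
  -- slack parameter `ε' = ε log 2 / 2`
  obtain ⟨K, hK, R₀, hR₀⟩ := hsub (ε * Real.log 2 / 2) (by positivity)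
  -- base scale `R = max R₀ 3`, `t₀ = log R ≥ 1`
  set R : ℕ := max R₀ 3 with hRdef
  have hR₀R : R₀ ≤ R := le_max_left _ _
  have h3R : 3 ≤ R := le_max_right _ _
  have hRpos : (0 : ℝ) < R := by exact_mod_cast lt_of_lt_of_le (by norm_num) h3R
  have ht₀ : 1 ≤ Real.log R := by
    rw [Real.le_log_iff_exp_le hRpos]
    have h3 : (3 : ℝ) ≤ R := by exact_mod_cast h3R
    linarith [Real.exp_one_lt_d9]
  set L : ℝ := max (Real.log K) 0 with hLdef
  have hL0 : 0 ≤ L := le_max_right _ _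
  obtain ⟨A, hA0, hA⟩ := QuasiPolynomialAbcOfEpsSubmult.exists_log_le_of_rad_le hS R
  have key := QuasiPolynomialAbcOfEpsSubmult.log_le_of_rad_le_pow hK hR₀ hR₀R
    (le_trans (by norm_num) h3R) hA
  refine ⟨2 * (A + L) + ε * Real.log 2 + (A + ε) / Real.log 2, fun a b c ht => ?_⟩
  -- the radical `r ≥ 2`
  have hr2 : 2 ≤ rad a b c := ht.two_le_rad
  have hr1 : (1 : ℝ) < (rad a b c : ℕ) := by exact_mod_cast hr2
  have hlogr : 0 < Real.log (rad a b c : ℕ) := Real.log_pos hr1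
  have hlogr2 : Real.log 2 ≤ Real.log (rad a b c : ℕ) :=
    Real.log_le_log two_pos (by exact_mod_cast hr2)
  -- `x log x ≥ x - 1 ≥ -1` at `x = log r`
  have hxlogx : -1 ≤ Real.log (rad a b c : ℕ) * Real.log (Real.log (rad a b c : ℕ)) := by
    have h := mul_le_mul_of_nonneg_left (Real.one_sub_inv_le_log_of_pos hlogr) hlogr.le
    rw [mul_sub, mul_one, mul_inv_cancel₀ hlogr.ne'] at h
    linarith
  have hεx : -ε ≤ ε * Real.log (rad a b c : ℕ) * Real.log (Real.log (rad a b c : ℕ)) := by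
    rw [mul_assoc]
    nlinarith
  -- minimal dyadic exponent `n` with `r ≤ R^(2^n)`
  have hex : ∃ n : ℕ, rad a b c ≤ R ^ 2 ^ n := by
    refine ⟨rad a b c, ?_⟩
    calc rad a b c ≤ 2 ^ rad a b c := Nat.lt_two_pow_self.le
      _ ≤ R ^ rad a b c := Nat.pow_le_pow_left (le_trans (by norm_num) h3R) _
      _ ≤ R ^ 2 ^ rad a b c := Nat.pow_le_pow_right (lt_of_lt_of_le (by norm_num) h3R)
          Nat.lt_two_pow_self.le
  classical
  obtain ⟨n, hn, hmin⟩ : ∃ n : ℕ, rad a b c ≤ R ^ 2 ^ n ∧ ∀ m : ℕ, m < n → ¬ rad a b c ≤ R ^ 2 ^ m :=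
    ⟨Nat.find hex, Nat.find_spec hex, fun m hm => Nat.find_min hex hm⟩
  have hC1 : A + ε ≤ (A + ε) / Real.log 2 * Real.log (rad a b c : ℕ) := by
    rw [div_mul_eq_mul_div, le_div_iff₀ hlog2]
    exact mul_le_mul_of_nonneg_left hlogr2 (by linarith)
  have hC2 : 0 ≤ (2 * (A + L) + ε * Real.log 2) * Real.log (rad a b c : ℕ) := by positivity
  have hC3 : 0 ≤ (A + ε) / Real.log 2 * Real.log (rad a b c : ℕ) := by positivity
  rcases n with _ | i
  · -- `n = 0`: `r ≤ R`, base bound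
    have hrR : rad a b c ≤ R := by simpa using hn
    have hlogc : Real.log c ≤ A := hA a b c ht hrR
    nlinarith
  · -- `n = i + 1`: `R^(2^i) < r ≤ R^(2^(i+1))`
    have hlt : R ^ 2 ^ i < rad a b c := not_le.mp (hmin i (Nat.lt_succ_self i))
    have hlogc := key (i + 1) a b c ht hn
    -- `2^i t₀ < log r`
    have hpow : (2 : ℝ) ^ i * Real.log R < Real.log (rad a b c : ℕ) := by
      have h : ((R : ℝ) ^ 2 ^ i) < (rad a b c : ℕ) := by exact_mod_cast hlt
      have h' := Real.log_lt_log (by positivity) h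
      rwa [Real.log_pow, Nat.cast_pow, Nat.cast_ofNat] at h'
    have h2i : (2 : ℝ) ^ i < Real.log (rad a b c : ℕ) := by
      have : (2 : ℝ) ^ i ≤ (2 : ℝ) ^ i * Real.log R :=
        le_mul_of_one_le_right (by positivity) ht₀
      linarith
    -- `i log 2 < log log r`
    have hi : (i : ℝ) * Real.log 2 < Real.log (Real.log (rad a b c : ℕ)) := by
      have h' := Real.log_lt_log (by positivity) h2i
      rwa [Real.log_pow] at h'
    have hi' : (i : ℝ) + 1 ≤ Real.log (Real.log (rad a b c : ℕ)) / Real.log 2 + 1 := by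
      rw [add_le_add_iff_right, le_div_iff₀ hlog2]
      exact hi.le
    -- assemble
    have hAL : 0 ≤ A + L := by positivity
    have step1 : (2 : ℝ) ^ (i + 1) * (A + L) ≤ 2 * Real.log (rad a b c : ℕ) * (A + L) := by
      have : (2 : ℝ) ^ (i + 1) ≤ 2 * Real.log (rad a b c : ℕ) := by rw [pow_succ]; linarith
      exact mul_le_mul_of_nonneg_right this hAL
    have step2 : ε * Real.log 2 / 2 * ((i : ℝ) + 1) * ((2 : ℝ) ^ (i + 1) * Real.log R) ≤
        ε * Real.log 2 / 2 * ((i : ℝ) + 1) * (2 * Real.log (rad a b c : ℕ)) := by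
      have : (2 : ℝ) ^ (i + 1) * Real.log R ≤ 2 * Real.log (rad a b c : ℕ) := by
        rw [pow_succ]; nlinarith
      exact mul_le_mul_of_nonneg_left this (by positivity)
    have step3 : ε * Real.log 2 / 2 * ((i : ℝ) + 1) * (2 * Real.log (rad a b c : ℕ)) ≤
        ε * Real.log 2 / 2 * (Real.log (Real.log (rad a b c : ℕ)) / Real.log 2 + 1) *
          (2 * Real.log (rad a b c : ℕ)) := by
      apply mul_le_mul_of_nonneg_right _ (by positivity)
      exact mul_le_mul_of_nonneg_left hi' (by positivity)
    have step4 : ε * Real.log 2 / 2 * (Real.log (Real.log (rad a b c : ℕ)) / Real.log 2 + 1) *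
          (2 * Real.log (rad a b c : ℕ)) =
        ε * Real.log 2 * Real.log (rad a b c : ℕ) +
          ε * Real.log (rad a b c : ℕ) * Real.log (Real.log (rad a b c : ℕ)) := by
      field_simp
      ring
    have hkey : Real.log c ≤ (2 : ℝ) ^ (i + 1) * (A + L) +
        ε * Real.log 2 / 2 * ((i : ℝ) + 1) * ((2 : ℝ) ^ (i + 1) * Real.log R) - L := by
      have := hlogc
      push_cast at this
      linarith
    nlinarith
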